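import Mathlib
import Summits.AtomisticToContinuum.Crystallization.Theses.PhononSlackCertificates
import Summits.AtomisticToContinuum.Crystallization.Theorems.PhononSlackCertificatesNearFarGlueRFibre
import Summits.AtomisticToContinuum.Crystallization.Theorems.PhononSlackCertificatesNearFarGlueRCoverFccSharp
import Summits.AtomisticToContinuum.Crystallization.Theorems.PhononSlackCertificatesNearFarGlueRCoverHcpSharp
import Summits.AtomisticToContinuum.Crystallization.Theorems.PhononSlackCertificatesNearFarGlueRDescentTight
import Summits.AtomisticToContinuum.Crystallization.Theorems.PhononSlackCertificatesNearFarGlueRGlueTight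
import Literature.MathematicalPhysics.StatisticalMechanics.LennardJonesClusters
import Literature.Geometry.DiscreteGeometry.TwoShellPatterns

/-!
# Crux `PhononSlackCertificates.NearFarGlueR` (stmt-AtomisticToContinuum-14970), line `Sketch`:
the reduction to the TIGHT contact gap (radius `21/20`)

Companion of `PhononSlackCertificatesNearFarGlueRReduction.lean` (radius `3`).  Skeleton v3 of the
line sharpens the residual to the physical interface layer: only 1/20-bad particles ADJACENT (within
`21/20`) to a 1/20-good particle are charged,

  `∀ δ > 0, ∃ g₂ > 0`, every `δ`-separated `x : Fin N → ℝ³` has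
  `N·e* + g₂ · #{j bad : some good particle lies within 21/20 of x j} ≤ 𝓔_LJ(x)`,

using the exact covering radius `45°` of both first coordination shells (`stub_coverFccSharp`,
`stub_coverHcpSharp`, constant `2/3`), descent from EVERY other particle (`stub_descentTight`:
goodness alone forces `dist ≥ 19a/20`, and `2d(2/3 − 1/20)a > (21a/20)²` for `d > 0.894a`), the
packing count `stub_fibre` and the bookkeeping `stub_glueTight` — all landed.  `stub_reductionTight`
/ `nearFarGlueR_of_tightContactGap` compose them (sorry-free); `tightContactGap_of_coerciveTwoShellGap`
is the converse; hence, given the two antecedents, target ⇔ contact gap ⇔ tight contact gap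
(`coerciveTwoShellGap_iff_tightContactGap` here, `coerciveTwoShellGap_iff_contactGap` there).  The tight contact gap
is the registered residual stub `stub_tightContactGap` of the line — crux-sized (it is the interface
part of `CoerciveTwoShellGap`: vacancies, free surfaces, intruders, displaced cages, priced against the
unknown periodic infimum `e*`).
-/

noncomputable section

namespace Summit.AtomisticToContinuum.Crystallization.Theorems.PhononSlackCertificatesNearFarGlueR

open Literature.MathematicalPhysics.StatisticalMechanics
open Literature.Geometry.DiscreteGeometry
open Summit.AtomisticToContinuum.Crystallization.Theses.PhononSlackCertificates
open scoped BigOperators RealInnerProductSpace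

/-! ## The tight residual (skeleton v3): contact radius `21/20` -/

/-- **The crux reduced to the TIGHT contact gap (sorry-free).**  If every `δ`-separated
configuration pays `g₂(δ) > 0` per 1/20-bad particle ADJACENT (within `21/20`) to a 1/20-good
particle, then `NearFarGlueR`.  Composition of the landed v3 stubs `stub_glueTight`,
`stub_descentTight`, `stub_coverFccSharp`, `stub_coverHcpSharp` and `stub_fibre`. [folklore] -/
theorem nearFarGlueR_of_tightContactGap
    (hCG : ∀ δ : ℝ, 0 < δ → ∃ g₂ : ℝ, 0 < g₂ ∧ ∀ (N : ℕ) (x : Fin N → EuclideanSpace ℝ (Fin 3)),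
      (∀ i j : Fin N, i ≠ j → δ ≤ dist (x i) (x j)) →
      (N : ℝ) * (⨅ Q : PeriodicConfiguration 3, Q.energyPerParticle lennardJones)
        + g₂ * (Nat.card {j : Fin N // ¬ IsTwoShellGood (1 / 20) (47 / 50) 1 x j ∧
            ∃ i : Fin N, IsTwoShellGood (1 / 20) (47 / 50) 1 x i ∧ dist (x i) (x j) ≤ 21 / 20} : ℝ)
        ≤ interactionEnergy lennardJones x) :
    NearFarGlueR := by
  unfold NearFarGlueR
  exact stub_glueTight (stub_descentTight stub_coverFccSharp stub_coverHcpSharp) stub_fibre hCG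

/-- **Registered stub `stub_reductionTight` of line `Sketch`** (the implication form of
`nearFarGlueR_of_tightContactGap`): the tight contact gap implies `NearFarGlueR`. [folklore] -/
theorem stub_reductionTight :
    (∀ δ : ℝ, 0 < δ → ∃ g₂ : ℝ, 0 < g₂ ∧ ∀ (N : ℕ) (x : Fin N → EuclideanSpace ℝ (Fin 3)),
      (∀ i j : Fin N, i ≠ j → δ ≤ dist (x i) (x j)) →
      (N : ℝ) * (⨅ Q : PeriodicConfiguration 3, Q.energyPerParticle lennardJones)
        + g₂ * (Nat.card {j : Fin N // ¬ IsTwoShellGood (1 / 20) (47 / 50) 1 x j ∧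
            ∃ i : Fin N, IsTwoShellGood (1 / 20) (47 / 50) 1 x i ∧ dist (x i) (x j) ≤ 21 / 20} : ℝ)
        ≤ interactionEnergy lennardJones x) → NearFarGlueR :=
  fun hCG => nearFarGlueR_of_tightContactGap hCG

/-- **The tight contact gap is weaker than the target**: `CoerciveTwoShellGap` implies it (the
tight contacts form a subset of the bad particles). [folklore] -/
theorem tightContactGap_of_coerciveTwoShellGap (h : CoerciveTwoShellGap) :
    ∀ δ : ℝ, 0 < δ → ∃ g₂ : ℝ, 0 < g₂ ∧ ∀ (N : ℕ) (x : Fin N → EuclideanSpace ℝ (Fin 3)),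
      (∀ i j : Fin N, i ≠ j → δ ≤ dist (x i) (x j)) →
      (N : ℝ) * (⨅ Q : PeriodicConfiguration 3, Q.energyPerParticle lennardJones)
        + g₂ * (Nat.card {j : Fin N // ¬ IsTwoShellGood (1 / 20) (47 / 50) 1 x j ∧
            ∃ i : Fin N, IsTwoShellGood (1 / 20) (47 / 50) 1 x i ∧ dist (x i) (x j) ≤ 21 / 20} : ℝ)
        ≤ interactionEnergy lennardJones x := by
  intro δ hδ
  obtain ⟨g, hg, hgap⟩ := h δ hδ
  refine ⟨g, hg, fun N x hsep => ?_⟩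
  have hmono : (Nat.card {j : Fin N // ¬ IsTwoShellGood (1 / 20) (47 / 50) 1 x j ∧
      ∃ i : Fin N, IsTwoShellGood (1 / 20) (47 / 50) 1 x i ∧ dist (x i) (x j) ≤ 21 / 20} : ℝ) ≤
      (Nat.card {i : Fin N // ¬ IsTwoShellGood (1 / 20) (47 / 50) 1 x i} : ℝ) := by
    exact_mod_cast Nat.card_le_card_of_injective
      (fun j : {j : Fin N // ¬ IsTwoShellGood (1 / 20) (47 / 50) 1 x j ∧
          ∃ i : Fin N, IsTwoShellGood (1 / 20) (47 / 50) 1 x i ∧ dist (x i) (x j) ≤ 21 / 20} =>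
        (⟨j.1, j.2.1⟩ : {i : Fin N // ¬ IsTwoShellGood (1 / 20) (47 / 50) 1 x i}))
      (fun a b hab => Subtype.ext (by simpa using congrArg Subtype.val hab))
  have := hgap N x hsep
  nlinarith [mul_le_mul_of_nonneg_left hmono hg.le]

/-- **Equivalence given the antecedents (tight form).**  Under `FarFieldGapR` and
`NearFieldConvexity`, `CoerciveTwoShellGap` holds iff the tight contact gap holds. [folklore] -/
theorem coerciveTwoShellGap_iff_tightContactGap (hFF : FarFieldGapR) (hNF : NearFieldConvexity) :
    CoerciveTwoShellGap ↔
    ∀ δ : ℝ, 0 < δ → ∃ g₂ : ℝ, 0 < g₂ ∧ ∀ (N : ℕ) (x : Fin N → EuclideanSpace ℝ (Fin 3)),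
      (∀ i j : Fin N, i ≠ j → δ ≤ dist (x i) (x j)) →
      (N : ℝ) * (⨅ Q : PeriodicConfiguration 3, Q.energyPerParticle lennardJones)
        + g₂ * (Nat.card {j : Fin N // ¬ IsTwoShellGood (1 / 20) (47 / 50) 1 x j ∧
            ∃ i : Fin N, IsTwoShellGood (1 / 20) (47 / 50) 1 x i ∧ dist (x i) (x j) ≤ 21 / 20} : ℝ)
        ≤ interactionEnergy lennardJones x :=
  ⟨tightContactGap_of_coerciveTwoShellGap, fun hCG => nearFarGlueR_of_tightContactGap hCG hFF hNF⟩

end Summit.AtomisticToContinuum.Crystallization.Theorems.PhononSlackCertificatesNearFarGlueR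

end
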